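import Mathlib
import HarnessLib
import Literature.Analysis.FluidPDE.ParasiticSlabFlow
import Summits.NavierStokesRegularity.NavierStokesRegularity.Theorems.PoloidalWindowRigidity.Negative.CellField
import Summits.NavierStokesRegularity.NavierStokesRegularity.Theorems.LrcModEntire.Negative.ThickColumnField

/-!
# Item `LrcModEntire` (stmt-NavierStokesRegularity-20428) — negative side: the THICK (NON-FROZEN) COLUMN, II: the
# Type-I profile, the absence of a shear slope, vorticity, twist bracket and class data

Negative-side support (refuter seat ns-regularity-refuter1; D-0081 §C), continuing `…Negative.ThickColumnField`:
`thickProfile t x = (−t)^{-1/2} V(x)` with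
* the directional derivatives `∂₂ vₕ`, `∇ₕ v₂`, `∂₂ v₂` in closed form, and **NO SHEAR SLOPE**: at a point with
  `sin x₀, sin x₁ ≠ 0`, `cos x₂, cos 2x₂ ≠ 0` the relations `∂₂ v_b = μ ∂_b v₂` (`b = 0, 1`) force `μ = −1` AND `μ = −4`
  (`thickProfile_no_slope`) — so the slope is a function of time, or of time and height, on no open set whatsoever;
* `curl v(t) = (−t)^{-1/2} K` (horizontal) and `D(curl v(t))` in closed form;
* the TWIST BRACKET `= (−t)^{-1} sin x₀ sin x₁ (P₁Q − Q₁P)(x₂)` (`thickProfile_twist`);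
* the class data (R) Type-I rate `10`, (C) continuity on the open backward slab, (D) divergence-free slices, (P) poloidal
  along `e₂`; and the FROZEN DEFECT `⟪Dv·curl v, e₂⟫ = 3(−t)^{-1} P Q sin x₀ sin x₁` (the witness is NOT frozen — this is
  exactly the freedom that deleting (M) restores).
WHAT THIS IS NOT: not a claim about Navier–Stokes regularity — explicit vector calculus for a kinematic witness. [folklore]
-/

noncomputable section

-- the summit and its single sub-problem share the name (CONVENTIONS §1), as in every Theorems file
set_option linter.dupNamespace false

namespace Summit.NavierStokesRegularity.NavierStokesRegularity.Theorems.LrcModEntire.Negative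

open MeasureTheory Set Function Filter Topology Metric
open scoped RealInnerProductSpace InnerProductSpace
open Literature.Analysis Literature.Analysis.FluidPDE
open Summit.NavierStokesRegularity.NavierStokesRegularity.Theorems.PoloidalWindowRigidity.Negative

local notation "E3" => EuclideanSpace ℝ (Fin 3)
local notation "π" i => (EuclideanSpace.proj (𝕜 := ℝ) (i : Fin 3) : EuclideanSpace ℝ (Fin 3) →L[ℝ] ℝ)
local notation "𝐞" i => (EuclideanSpace.single (i : Fin 3) (1 : ℝ) : EuclideanSpace ℝ (Fin 3))

/-! ## The thick column Type-I profile `v(t, x) = (−t)^{-1/2} V(x)` -/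

/-- `Dv(t) = (−t)^{-1/2} DV`. [folklore] -/
theorem fderiv_thickProfile (t : ℝ) (x : E3) : fderiv ℝ (thickProfile t) x = cellAmp t • thickDeriv x :=
  ((hasFDerivAt_thickField x).const_smul (cellAmp t)).fderiv

/-- `Dv(t)(x) w` in coordinates. [folklore] -/
theorem fderiv_thickProfile_apply (t : ℝ) (x w : E3) (i : Fin 3) :
    fderiv ℝ (thickProfile t) x w i = cellAmp t * thickDeriv x w i := by
  rw [fderiv_thickProfile]; rfl

/-- `∂₂ v₀ = (−t)^{-1/2} P sin x₀`. [folklore] -/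
theorem fderiv_thickProfile_e2_apply_zero (t : ℝ) (x : E3) :
    fderiv ℝ (thickProfile t) x (𝐞 2) 0 = cellAmp t * (thickP (x 2) * Real.sin (x 0)) := by
  rw [fderiv_thickProfile_apply, thickDeriv_apply_zero, show (𝐞 2) 0 = 0 by simp, show (𝐞 2) 2 = 1 by simp]
  ring

/-- `∂₂ v₁ = 4(−t)^{-1/2} Q sin x₁`. [folklore] -/
theorem fderiv_thickProfile_e2_apply_one (t : ℝ) (x : E3) :
    fderiv ℝ (thickProfile t) x (𝐞 2) 1 = cellAmp t * (4 * thickQ (x 2) * Real.sin (x 1)) := by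
  rw [fderiv_thickProfile_apply, thickDeriv_apply_one, show (𝐞 2) 1 = 0 by simp, show (𝐞 2) 2 = 1 by simp]
  ring

/-- `∂₂ v₂ = (−t)^{-1/2} (P₁ cos x₀ + Q₁ cos x₁)`. [folklore] -/
theorem fderiv_thickProfile_e2_apply_two (t : ℝ) (x : E3) :
    fderiv ℝ (thickProfile t) x (𝐞 2) 2 =
      cellAmp t * (thickP₁ (x 2) * Real.cos (x 0) + thickQ₁ (x 2) * Real.cos (x 1)) := by
  rw [fderiv_thickProfile_apply, thickDeriv_apply_two, show (𝐞 2) 0 = 0 by simp, show (𝐞 2) 1 = 0 by simp,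
    show (𝐞 2) 2 = 1 by simp]
  ring

/-- `∂₀ v₂ = −(−t)^{-1/2} P sin x₀`. [folklore] -/
theorem fderiv_thickProfile_e0_apply_two (t : ℝ) (x : E3) :
    fderiv ℝ (thickProfile t) x (𝐞 0) 2 = cellAmp t * (-(thickP (x 2) * Real.sin (x 0))) := by
  rw [fderiv_thickProfile_apply, thickDeriv_apply_two, show (𝐞 0) 0 = 1 by simp, show (𝐞 0) 1 = 0 by simp,
    show (𝐞 0) 2 = 0 by simp]
  ring

/-- `∂₁ v₂ = −(−t)^{-1/2} Q sin x₁`. [folklore] -/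
theorem fderiv_thickProfile_e1_apply_two (t : ℝ) (x : E3) :
    fderiv ℝ (thickProfile t) x (𝐞 1) 2 = cellAmp t * (-(thickQ (x 2) * Real.sin (x 1))) := by
  rw [fderiv_thickProfile_apply, thickDeriv_apply_two, show (𝐞 1) 0 = 0 by simp, show (𝐞 1) 1 = 1 by simp,
    show (𝐞 1) 2 = 0 by simp]
  ring

/-- **NO SHEAR SLOPE.**  At a space–time point with `t < 0`, `sin x₀ > 0`, `sin x₁ > 0`, `P(x₂) > 0`, `Q(x₂) > 0`, no
real `μ` satisfies both `∂₂ v₀ = μ ∂₀ v₂` and `∂₂ v₁ = μ ∂₁ v₂`: the first forces `μ = −1`, the second `μ = −4`.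
[folklore] -/
theorem thickProfile_no_slope {t : ℝ} (ht : t < 0) {x : E3} (hs0 : 0 < Real.sin (x 0)) (hs1 : 0 < Real.sin (x 1))
    (hP : 0 < thickP (x 2)) (hQ : 0 < thickQ (x 2)) (μ : ℝ)
    (h0 : fderiv ℝ (thickProfile t) x (𝐞 2) 0 = μ * fderiv ℝ (thickProfile t) x (𝐞 0) 2)
    (h1 : fderiv ℝ (thickProfile t) x (𝐞 2) 1 = μ * fderiv ℝ (thickProfile t) x (𝐞 1) 2) : False := by
  rw [fderiv_thickProfile_e2_apply_zero, fderiv_thickProfile_e0_apply_two] at h0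
  rw [fderiv_thickProfile_e2_apply_one, fderiv_thickProfile_e1_apply_two] at h1
  have hc := cellAmp_pos ht
  have hA : 0 < cellAmp t * (thickP (x 2) * Real.sin (x 0)) := mul_pos hc (mul_pos hP hs0)
  have hB : 0 < cellAmp t * (thickQ (x 2) * Real.sin (x 1)) := mul_pos hc (mul_pos hQ hs1)
  have e0 : (1 + μ) * (cellAmp t * (thickP (x 2) * Real.sin (x 0))) = 0 := by linear_combination h0
  have e1 : (4 + μ) * (cellAmp t * (thickQ (x 2) * Real.sin (x 1))) = 0 := by linear_combination h1
  rcases mul_eq_zero.1 e0 with h | h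
  · rcases mul_eq_zero.1 e1 with h' | h'
    · linarith
    · exact hB.ne' h'
  · exact hA.ne' h

/-- **The vorticity of the thick column**: `curl v(t) = (−t)^{-1/2} K`, horizontal. [folklore] -/
theorem curl_thickProfile (t : ℝ) (x : E3) : curl (thickProfile t) x = cellAmp t • thickVort x := by
  ext i
  fin_cases i <;>
    simp [curl, thickVort, fderiv_thickProfile, thickDeriv_apply_zero, thickDeriv_apply_one,
      thickDeriv_apply_two] <;> ring

/-- The vorticity slice as a function. [folklore] -/
theorem curl_thickProfile_eq (t : ℝ) : curl (thickProfile t) = fun x => cellAmp t • thickVort x :=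
  funext (curl_thickProfile t)

/-- The first component of `curl v(t)(x)`. [folklore] -/
theorem curl_thickProfile_apply_zero (t : ℝ) (x : E3) :
    curl (thickProfile t) x 0 = -(cellAmp t * (5 * thickQ (x 2) * Real.sin (x 1))) := by
  rw [curl_thickProfile]; simp [thickVort]

/-- The second component of `curl v(t)(x)`. [folklore] -/
theorem curl_thickProfile_apply_one (t : ℝ) (x : E3) :
    curl (thickProfile t) x 1 = cellAmp t * (2 * thickP (x 2) * Real.sin (x 0)) := by
  rw [curl_thickProfile]; simp [thickVort]

/-- The third component of `curl v(t)(x)` vanishes (poloidal along `e₂`). [folklore] -/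
theorem curl_thickProfile_apply_two (t : ℝ) (x : E3) : curl (thickProfile t) x 2 = 0 := by
  rw [curl_thickProfile]; simp [thickVort]

/-- `D(curl v(t)) = (−t)^{-1/2} DK`. [folklore] -/
theorem hasFDerivAt_curl_thickProfile (t : ℝ) (x : E3) :
    HasFDerivAt (curl (thickProfile t)) (cellAmp t • thickVortDeriv x) x := by
  rw [curl_thickProfile_eq]
  exact (hasFDerivAt_thickVort x).const_smul (cellAmp t)

/-- `D(curl v(t))(x) w` in coordinates. [folklore] -/
theorem fderiv_curl_thickProfile_apply (t : ℝ) (x w : E3) (i : Fin 3) :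
    fderiv ℝ (curl (thickProfile t)) x w i = cellAmp t * thickVortDeriv x w i := by
  rw [(hasFDerivAt_curl_thickProfile t x).fderiv]; rfl

/-- The first component of `D(curl v(t))(x) w`. [folklore] -/
theorem fderiv_curl_thickProfile_apply_zero (t : ℝ) (x w : E3) :
    fderiv ℝ (curl (thickProfile t)) x w 0 =
      -(cellAmp t * ((5 * thickQ (x 2)) * (Real.cos (x 1) * w 1) + Real.sin (x 1) * ((5 * thickQ₁ (x 2)) * w 2))) := by
  rw [fderiv_curl_thickProfile_apply, thickVortDeriv_apply_zero, mul_neg]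

/-- The second component of `D(curl v(t))(x) w`. [folklore] -/
theorem fderiv_curl_thickProfile_apply_one (t : ℝ) (x w : E3) :
    fderiv ℝ (curl (thickProfile t)) x w 1 =
      cellAmp t * ((2 * thickP (x 2)) * (Real.cos (x 0) * w 0) + Real.sin (x 0) * ((2 * thickP₁ (x 2)) * w 2)) := by
  rw [fderiv_curl_thickProfile_apply, thickVortDeriv_apply_one]

/-! ## `∂₂v₂` as a differentiable function of the point and the twist bracket -/

/-- `x ↦ ∂₂v₂(t, x)` is differentiable with derivative `thickDzVzDeriv t x`. [folklore] -/
theorem hasFDerivAt_fderiv_thickProfile_e2_two (t : ℝ) (x : E3) :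
    HasFDerivAt (fun y : E3 => fderiv ℝ (thickProfile t) y (𝐞 2) 2) (thickDzVzDeriv t x) x := by
  have e : (fun y : E3 => fderiv ℝ (thickProfile t) y (𝐞 2) 2) =
      fun y => cellAmp t * (thickP₁ (y 2) * Real.cos (y 0) + thickQ₁ (y 2) * Real.cos (y 1)) :=
    funext (fderiv_thickProfile_e2_apply_two t)
  rw [e]
  have h0 : HasFDerivAt (fun y : E3 => y 0) (π 0) x := (π 0).hasFDerivAt
  have h1 : HasFDerivAt (fun y : E3 => y 1) (π 1) x := (π 1).hasFDerivAt
  have h2 : HasFDerivAt (fun y : E3 => y 2) (π 2) x := (π 2).hasFDerivAt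
  have hc0 := (Real.hasDerivAt_cos (x 0)).comp_hasFDerivAt x h0
  have hc1 := (Real.hasDerivAt_cos (x 1)).comp_hasFDerivAt x h1
  have hP1 := (hasDerivAt_thickP₁ (x 2)).comp_hasFDerivAt x h2
  have hQ1 := (hasDerivAt_thickQ₁ (x 2)).comp_hasFDerivAt x h2
  have H := ((hP1.mul hc0).add (hQ1.mul hc1)).const_mul (cellAmp t)
  exact H

/-- `D(∂₂v₂)(t, x) w` in coordinates. [folklore] -/
theorem thickDzVzDeriv_apply (t : ℝ) (x w : E3) : thickDzVzDeriv t x w =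
    cellAmp t * ((thickP₁ (x 2) * (-(Real.sin (x 0)) * w 0) + Real.cos (x 0) * ((-thickP (x 2)) * w 2)) +
      (thickQ₁ (x 2) * (-(Real.sin (x 1)) * w 1) + Real.cos (x 1) * ((-(4 * thickQ (x 2))) * w 2))) := by
  rfl

/-- `∂₀(∂₂v₂) = −(−t)^{-1/2} P₁ sin x₀`. [folklore] -/
theorem fderiv_fderiv_thickProfile_e2_two_e0 (t : ℝ) (x : E3) :
    fderiv ℝ (fun y : E3 => fderiv ℝ (thickProfile t) y (𝐞 2) 2) x (𝐞 0) =
      cellAmp t * (-(thickP₁ (x 2) * Real.sin (x 0))) := by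
  rw [(hasFDerivAt_fderiv_thickProfile_e2_two t x).fderiv, thickDzVzDeriv_apply, show (𝐞 0) 0 = 1 by simp,
    show (𝐞 0) 1 = 0 by simp, show (𝐞 0) 2 = 0 by simp]
  ring

/-- `∂₁(∂₂v₂) = −(−t)^{-1/2} Q₁ sin x₁`. [folklore] -/
theorem fderiv_fderiv_thickProfile_e2_two_e1 (t : ℝ) (x : E3) :
    fderiv ℝ (fun y : E3 => fderiv ℝ (thickProfile t) y (𝐞 2) 2) x (𝐞 1) =
      cellAmp t * (-(thickQ₁ (x 2) * Real.sin (x 1))) := by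
  rw [(hasFDerivAt_fderiv_thickProfile_e2_two t x).fderiv, thickDzVzDeriv_apply, show (𝐞 1) 0 = 0 by simp,
    show (𝐞 1) 1 = 1 by simp, show (𝐞 1) 2 = 0 by simp]
  ring

/-- **The twist bracket** `∂₀(∂₂v₂)·∂₁v₂ − ∂₁(∂₂v₂)·∂₀v₂ = (−t)^{-1} sin x₀ sin x₁ (P₁Q − Q₁P)(x₂)`. [folklore] -/
theorem thickProfile_twist (z : ℝ × E3) :
    fderiv ℝ (fun x => fderiv ℝ (thickProfile z.1) x (𝐞 2) 2) z.2 (𝐞 0) *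
          fderiv ℝ (thickProfile z.1) z.2 (𝐞 1) 2 -
        fderiv ℝ (fun x => fderiv ℝ (thickProfile z.1) x (𝐞 2) 2) z.2 (𝐞 1) *
          fderiv ℝ (thickProfile z.1) z.2 (𝐞 0) 2 =
      cellAmp z.1 ^ 2 * (Real.sin (z.2 0) * Real.sin (z.2 1)) *
        (thickP₁ (z.2 2) * thickQ (z.2 2) - thickQ₁ (z.2 2) * thickP (z.2 2)) := by
  rw [fderiv_fderiv_thickProfile_e2_two_e0, fderiv_fderiv_thickProfile_e2_two_e1, fderiv_thickProfile_e0_apply_two,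
    fderiv_thickProfile_e1_apply_two]
  ring

/-! ## The class hypotheses (R), (C), (D), (P); the frozen defect -/

/-- `‖v(t)(x)‖ ≤ 10 (−t)^{-1/2}`. [folklore] -/
theorem norm_thickProfile_le (t : ℝ) (x : E3) : ‖thickProfile t x‖ ≤ cellAmp t * 10 := by
  unfold thickProfile
  rw [norm_smul, Real.norm_of_nonneg (cellAmp_nonneg t)]
  exact mul_le_mul_of_nonneg_left (norm_thickField_le x) (cellAmp_nonneg t)

/-- (R) the Type-I time rate with constant `10`. [folklore] -/
theorem hasTypeITimeDecay_thickProfile : HasTypeITimeDecay 10 thickProfile := by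
  intro t _ x
  have h := norm_thickProfile_le t x
  rw [cellAmp] at h
  rw [div_eq_inv_mul]
  exact h

/-- (C) continuity on the open backward slab. [folklore] -/
theorem continuousOn_thickProfile :
    ContinuousOn (Function.uncurry thickProfile) (Set.Iio (0 : ℝ) ×ˢ Set.univ) := by
  have hamp : ContinuousOn (fun z : ℝ × E3 => cellAmp z.1) (Set.Iio (0 : ℝ) ×ˢ Set.univ) := by
    refine ContinuousOn.inv₀ ?_ fun z hz => (Real.sqrt_pos.2 (neg_pos.2 (show z.1 < 0 from hz.1))).ne'
    exact ((Real.continuous_sqrt.comp continuous_neg).comp continuous_fst).continuousOn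
  exact hamp.smul (continuous_thickField.comp continuous_snd).continuousOn

/-- (D) divergence-free slices: `div V = −P₁ cos x₀ − Q₁ cos x₁ + (P₁ cos x₀ + Q₁ cos x₁) = 0`. [folklore] -/
theorem isDivFree_thickProfile (t : ℝ) : VectorCalculus.IsDivFree (thickProfile t) := by
  intro y
  rw [divergence_eq_sum_inner_fderiv (EuclideanSpace.basisFun (Fin 3) ℝ), Fin.sum_univ_three]
  simp only [EuclideanSpace.basisFun_apply, EuclideanSpace.inner_single_left, map_one, one_mul,
    fderiv_thickProfile_apply, thickDeriv_apply_zero, thickDeriv_apply_one, thickDeriv_apply_two, PiLp.single_apply]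
  simp
  ring

/-- (P) poloidal along `e₂` everywhere on every slice. [folklore] -/
theorem poloidal_thickProfile (s : ℝ) (y : E3) : ⟪curl (thickProfile s) y, (𝐞 2)⟫_ℝ = 0 := by
  rw [EuclideanSpace.inner_single_right, curl_thickProfile_apply_two]
  simp

/-- **The frozen defect**: `⟪Dv(s)(y)·curl v(s)(y), e₂⟫ = 3(−s)^{-1} P Q sin y₀ sin y₁` — the thick column is NOT frozen
(off the coordinate hyperplanes); this is the (M)-consequence it is free to violate. [folklore] -/
theorem frozen_defect_thickProfile (s : ℝ) (y : E3) :
    ⟪fderiv ℝ (thickProfile s) y (curl (thickProfile s) y), (𝐞 2)⟫_ℝ =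
      3 * cellAmp s ^ 2 * (thickP (y 2) * thickQ (y 2) * (Real.sin (y 0) * Real.sin (y 1))) := by
  rw [EuclideanSpace.inner_single_right, fderiv_thickProfile_apply, thickDeriv_apply_two,
    curl_thickProfile_apply_zero, curl_thickProfile_apply_one, curl_thickProfile_apply_two, RCLike.conj_to_real]
  ring

end Summit.NavierStokesRegularity.NavierStokesRegularity.Theorems.LrcModEntire.Negative

end
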